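import Summits.QuantumFields.BalabanUV.Beta.GAN24.WardResidualSRecursion
import Summits.QuantumFields.BalabanUV.Beta.GAN24.BiStencilZeroMode

/-!
# `BalabanUV.Beta.GAN24.WardResidualSUnroll` — binder row G-an2-4 / (CONV-C), CT-W route of record «WC-TL», located crux (Q-R) ∕ (Q-Φ):
# **THE BLOCK-SUMMED S-TOWER UNROLLED — BLOCK SUMS NEST.**  For the table tower of `WardResidualSRecursion(All)` — `Φ (j+1) Y = Σ_{v∈box} c_j • e3OfK N G_j (Φ j (N•Y+v)) + σ_j Y`
# (the S-STEP with a block-summed passive label) — the discrete Duhamel formula holds on BOUNDED label-tables (leaf-01's `AffineUnroll` engine), and the `k`-fold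
# composite of the block-summed S-step FACTORISES as (the `k`-fold composite of the PLAIN S-steps) ∘ (the block sum over the `N^k`-block of the label):
# `transport 𝔄 m k Φ = fun Ȳ ↦ Σ_{w ∈ box (N^k)} transport 𝔖 m k (Φ (N^k•Ȳ + w))` — the label range stays put while the block grows to `N^k`
# (idea-1's WARD5 (3.3) «block sums nest», typed; road-P2 chair `b2b-balaban-gan24-p2`, gen 37, part 3 of INTENT journal 2026-08-22T03:12Z).

NOT IN PRINT; OUR BOOKKEEPING ([folklore] algebra: `AffineUnroll` + the bounded-table calculus of `Lin4Additive` ∕ `WardResidualSRecursion` + the box-nesting bijection of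
leaf-02's `PsiParentBlockMeans.blockSum_mul`, here for group-valued summands).  HONEST FRAMING (cell contract, verbatim): «discharging `BetaPertH` makes Bałaban's UV stability
UNCONDITIONAL — a real constructive-QFT result; it is NOT the continuum limit and NOT the Clay problem.»  HONEST DEPENDENCY (verbatim): «continuum YM on T⁴ ⇐ BetaPertH ∧ nine
spine estimates (0/9 proved); BetaPertH ⇐ (D1) ∧ (D4) ∧ CAP+tail; G-an2-4 gates asym, D1 and NE2/3/4.»  No cited fact, no `def`, no `def … : Prop`, 0 sorry; GENERIC in the
kernel family `G : ℕ → MKer` (decaying), the scalars `c : ℕ → ℝ` and the blocking `N ≥ 1` — the comb instance is `G j = coDressKBmAt ρ Lc (KInvStep Lc j)`, `c j = Lc^{d+1}·wE (j+1)`, `N = Lc`.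

* §1 the S-step on BOUNDED tables: `bdd_e3OfK` (boundedness is preserved), **`e3OfK_add_of_bdd`** (additivity; `vertexOfK_add` + `sandwich_add` + `mmRead_add`).
* §2 `sum_box_mul` — NESTED BLOCK SUMS for any additive-monoid-valued summand: `Σ_{b∈box (M·L)} F ((M·L)•Y + b) = Σ_{c∈box L} Σ_{r∈box M} F (M•(L•Y + c) + r)`; `sum_box_one` (over
  leaf-01's `BiStencilZeroMode.box_one`).
* §3 **`transport_blockSStep_eq`** — BLOCK SUMS NEST: the `k`-fold transport of the block-summed S-steps `𝔄 j Φ := fun Y κ′u′ ↦ Σ_{v∈box N} c j • e3OfK N (G j) (Φ (N•Y+v)) κ′u′`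
  on a bounded label-table IS `fun Ȳ κ′u′ ↦ Σ_{w∈box (N^k)} transport 𝔖 m k (Φ (N^k•Ȳ + w)) κ′u′`, `𝔖 j S := fun κ′u′ ↦ c j • e3OfK N (G j) S κ′u′` the PLAIN S-steps.
* §4 **`eq_transport_add_sum_blockSStep`** — DUHAMEL for any bounded tower `Φ (j+1) = 𝔄 j (Φ j) + σ j` with bounded sources; **`apply_eq_sum_box_transport`**: its member `n`
  at label `Ȳ` = `Σ_{w∈box (N^n)} transport 𝔖 0 n (Φ 0 (N^n•Ȳ + w)) + Σ_{m<n} Σ_{w∈box (N^{n−1−m})} transport 𝔖 (m+1) (n−1−m) (σ m (N^{n−1−m}•Ȳ + w))` — every source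
  transported by the PLAIN S-tower's composite maps and block-summed over the grown block (WARD5 (3.3)); **`apply_eq_transport_blockSum`**: equivalently the composite
  maps applied to the SUPER-BLOCK PARTIAL SUMS `Σ_{w∈box (N^m)} σ (N^m•Ȳ + w)` — the OWNER gan24-p1 g25's «QR-LL» shape (W2): with the label partial-sum identities every
  transported object is a first-order LETTER dressed with the super-block generator, supported on a boundary LAYER (rows (LAY) ∕ (LT) ∕ (DUH) start here).
Asserts NO bound, NO rate; discharges NOTHING of (Q-R) ∕ (Q-Φ) ∕ (C) ∕ «T2Shape» ∕ «T2Drift» ∕ (hW, hWall); NEVER «G-an2-4 closed» as (CONV-C); NOT D1, NOT BetaPertH, NOT continuum,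
NOT Clay.  Unit `b2b-balaban-gan24-p2` (gen 37), 2026-08-22; no existing file touched.
-/

noncomputable section

open Finset
open scoped BigOperators
open Literature.MathematicalPhysics.QuantumFieldTheory
open Literature.MathematicalPhysics.QuantumFieldTheory.Balaban1983to89
open Literature.MathematicalPhysics.QuantumFieldTheory.Balaban1983to89.Beta
open ExpKernelCalculus (MKer Decays comp)
open KernelWard (Bdd)
open AffineAveraging (Site box toSite)
open OneStepResolventKernel (Fib LocStencil)
open OneStepKernelFamily (vertexOfK)
open BalabanStepJetsSucc (mmRead)
open Summit.QuantumFields.BalabanUV.Beta.TameKernelCalculus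
open Summit.QuantumFields.BalabanUV.Beta.ChartConjugationReflection (vertexOfK_add)
open Summit.QuantumFields.BalabanUV.Beta.SpineRooted (e3OfK e3OfK_apply)
open Summit.QuantumFields.BalabanUV.Beta.VertexReflectionContact (mmRead_add)
open Summit.QuantumFields.BalabanUV.Beta.GAN24.Lin4Additive (abs_vertexOfK_le bdd_comp_decays_bdd bdd_comp_bdd_decays bdd_mmRead)
open Summit.QuantumFields.BalabanUV.Beta.GAN24.AffineUnroll (transport transport_zero transport_succ' transport_sum transport_mem eq_transport_add_sum)
open Summit.QuantumFields.BalabanUV.Beta.GAN24.WardResidualSRecursion (mmRead_sandwich_vertexOfK sandwich_add)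
open Summit.QuantumFields.BalabanUV.Beta.GAN24.BiStencilZeroMode (box_one)

namespace Summit.QuantumFields.BalabanUV.Beta.GAN24.WardResidualSUnroll

variable {d : ℕ}

/-! ## §1 The S-step on bounded tables -/

/-- [folklore] **THE S-STEP PRESERVES BOUNDEDNESS**: for a decaying `K` and a table with entries bounded by `B`, every `e3OfK N K S κ u` has entries bounded by an explicit
constant (vertex bound `abs_vertexOfK_le`, two compositions, the `mm`-read, a sign). -/
theorem bdd_e3OfK {K : MKer (d + 1) (Fib d)} {C δ : ℝ} (hK : Decays K C δ) (hδ : 0 < δ) (N : ℕ)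
    {S : Fin (d + 1) → (Fin (d + 1) → ℤ) → MKer (d + 1) (Fib d)} {B : ℝ} (hS : ∀ κ u x z a b, |S κ u x z a b| ≤ B)
    (κ : Fin (d + 1)) (u : Fin (d + 1) → ℤ) :
    Bdd (e3OfK N K S κ u) ((Fintype.card (Fib d) : ℝ) * ((Fintype.card (Fib d) : ℝ) *
      (C * ExpKernelCalculus.Zl (d + 1) δ * (((d + 1 : ℕ) : ℝ) * (C * ExpKernelCalculus.Zl (d + 1) δ * B))) * (C * ExpKernelCalculus.Zl (d + 1) δ))) := by
  have hV : Bdd (vertexOfK K N S κ u) (((d + 1 : ℕ) : ℝ) * (C * ExpKernelCalculus.Zl (d + 1) δ * B)) :=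
    fun x z a b => abs_vertexOfK_le hK hδ N hS κ u x z a b
  have h := bdd_mmRead (bdd_comp_bdd_decays (bdd_comp_decays_bdd hK hδ hV) hK hδ) N
  intro x z a b
  rw [e3OfK_apply, abs_neg]
  exact h x z a b

/-- [folklore] **THE S-STEP IS ADDITIVE ON BOUNDED TABLES** (decaying `K`): `e3OfK N K (S + T) κ u = e3OfK N K S κ u + e3OfK N K T κ u`. -/
theorem e3OfK_add_of_bdd {K : MKer (d + 1) (Fib d)} {C δ : ℝ} (hK : Decays K C δ) (hδ : 0 < δ) (hC : 0 ≤ C) (N : ℕ)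
    {S T : Fin (d + 1) → (Fin (d + 1) → ℤ) → MKer (d + 1) (Fib d)} {BS BT : ℝ}
    (hS : ∀ κ u x z a b, |S κ u x z a b| ≤ BS) (hT : ∀ κ u x z a b, |T κ u x z a b| ≤ BT) (κ : Fin (d + 1)) (u : Fin (d + 1) → ℤ) :
    e3OfK N K (fun κ' u' => S κ' u' + T κ' u') κ u = e3OfK N K S κ u + e3OfK N K T κ u := by
  have hS' : ∀ κ u x z a b, |S κ u x z a b| ≤ max BS BT := fun κ u x z a b => (hS κ u x z a b).trans (le_max_left _ _)
  have hT' : ∀ κ u x z a b, |T κ u x z a b| ≤ max BS BT := fun κ u x z a b => (hT κ u x z a b).trans (le_max_right _ _)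
  have hVS : Bdd (vertexOfK K N S κ u) (((d + 1 : ℕ) : ℝ) * (C * ExpKernelCalculus.Zl (d + 1) δ * max BS BT)) :=
    fun x z a b => abs_vertexOfK_le hK hδ N hS' κ u x z a b
  have hVT : Bdd (vertexOfK K N T κ u) (((d + 1 : ℕ) : ℝ) * (C * ExpKernelCalculus.Zl (d + 1) δ * max BS BT)) :=
    fun x z a b => abs_vertexOfK_le hK hδ N hT' κ u x z a b
  have e : -e3OfK N K (fun κ' u' => S κ' u' + T κ' u') κ u = -(e3OfK N K S κ u + e3OfK N K T κ u) := by
    rw [← mmRead_sandwich_vertexOfK, vertexOfK_add (N := N) ⟨δ, C, hδ, hC, hK⟩ hS' hT' κ u, sandwich_add hK hδ hVS hVT, mmRead_add,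
      mmRead_sandwich_vertexOfK, mmRead_sandwich_vertexOfK, neg_add]
  exact neg_injective e

/-! ## §2 Nested block sums (group-valued) -/

/-- [folklore] membership in `box`, coordinatewise. -/
theorem mem_box_iff {n L : ℕ} {b : Fin n → ℕ} : b ∈ box n L ↔ ∀ i, b i < L := by
  simp [AffineAveraging.box, Fintype.mem_piFinset, Finset.mem_range]

/-- [folklore] **NESTED BLOCK SUMS** for a summand valued in any additive commutative monoid: a block of side `M·L` is the disjoint union of the `L^n` blocks of side `M`
labelled by the block of side `L` — `Σ_{b∈box (M·L)} F ((M·L)•Y + b) = Σ_{c∈box L} Σ_{r∈box M} F (M•(L•Y + c) + r)` (the bijection `(c, r) ↦ M•c + r` of leaf-02's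
`PsiParentBlockMeans.blockSum_mul`). -/
theorem sum_box_mul {E : Type*} [AddCommMonoid E] {n M : ℕ} (hM : 1 ≤ M) (L : ℕ) (F : Site n → E) (Y : Site n) :
    ∑ b ∈ box n (M * L), F (((M * L : ℕ) : ℤ) • Y + toSite b) = ∑ c ∈ box n L, ∑ r ∈ box n M, F ((M : ℤ) • ((L : ℤ) • Y + toSite c) + toSite r) := by
  rw [← Finset.sum_product']
  symm
  refine Finset.sum_nbij' (fun p => fun i => M * p.1 i + p.2 i) (fun b => (fun i => b i / M, fun i => b i % M)) ?_ ?_ ?_ ?_ ?_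
  · intro p hp
    rw [Finset.mem_product] at hp
    rw [mem_box_iff]
    intro i
    have h1 := (mem_box_iff.mp hp.1) i
    have h2 := (mem_box_iff.mp hp.2) i
    calc M * p.1 i + p.2 i < M * p.1 i + M := by omega
      _ = M * (p.1 i + 1) := by ring
      _ ≤ M * L := Nat.mul_le_mul_left M h1
  · intro b hb
    rw [Finset.mem_product, mem_box_iff, mem_box_iff]
    have hb' := mem_box_iff.mp hb
    refine ⟨fun i => ?_, fun i => Nat.mod_lt _ hM⟩
    have h := hb' i
    exact Nat.div_lt_of_lt_mul (by simpa [Nat.mul_comm] using h)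
  · intro p hp
    rw [Finset.mem_product] at hp
    have h2 := mem_box_iff.mp hp.2
    ext i
    · show (M * p.1 i + p.2 i) / M = p.1 i
      rw [add_comm, Nat.add_mul_div_left _ _ hM, Nat.div_eq_of_lt (h2 i), zero_add]
    · show (M * p.1 i + p.2 i) % M = p.2 i
      rw [add_comm, Nat.add_mul_mod_self_left, Nat.mod_eq_of_lt (h2 i)]
  · intro b _
    funext i
    exact Nat.div_add_mod (b i) M
  · intro p _
    congr 1
    funext i
    simp only [toSite, Pi.add_apply, Pi.smul_apply, smul_eq_mul, Nat.cast_add, Nat.cast_mul]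
    ring

/-- [folklore] The block sum over the box of side `1` is the value at the label itself. -/
theorem sum_box_one {E : Type*} [AddCommMonoid E] {n : ℕ} (F : Site n → E) (Y : Site n) :
    ∑ b ∈ box n 1, F (((1 : ℕ) : ℤ) • Y + toSite b) = F Y := by
  rw [box_one, Finset.sum_singleton]
  congr 1
  funext i
  simp

/-! ## §3 Block sums nest: the composite of the block-summed S-steps factorises -/

section Nest

variable (N : ℕ) (G : ℕ → MKer (d + 1) (Fib d)) (c : ℕ → ℝ)

/-- [folklore] The PLAIN S-steps preserve boundedness. -/
theorem bdd_sStep (hG : ∀ j, ∃ δ C : ℝ, 0 < δ ∧ 0 ≤ C ∧ Decays (G j) C δ) (j : ℕ)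
    {S : Fin (d + 1) → (Fin (d + 1) → ℤ) → MKer (d + 1) (Fib d)} (hS : ∃ B : ℝ, ∀ κ u x z a b, |S κ u x z a b| ≤ B) :
    ∃ B : ℝ, ∀ κ u x z a b, |(fun κ' u' => c j • e3OfK N (G j) S κ' u') κ u x z a b| ≤ B := by
  obtain ⟨δ, C, hδ, _, hK⟩ := hG j
  obtain ⟨B, hB⟩ := hS
  refine ⟨|c j| * ((Fintype.card (Fib d) : ℝ) * ((Fintype.card (Fib d) : ℝ) *
      (C * ExpKernelCalculus.Zl (d + 1) δ * (((d + 1 : ℕ) : ℝ) * (C * ExpKernelCalculus.Zl (d + 1) δ * B))) * (C * ExpKernelCalculus.Zl (d + 1) δ))),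
    fun κ u x z a b => ?_⟩
  show |(c j • e3OfK N (G j) S κ u) x z a b| ≤ _
  rw [Pi.smul_apply, Pi.smul_apply, Pi.smul_apply, Pi.smul_apply, smul_eq_mul, abs_mul]
  exact mul_le_mul_of_nonneg_left (bdd_e3OfK hK hδ N hB κ u x z a b) (abs_nonneg _)

/-- [folklore] The PLAIN S-steps are additive on bounded tables. -/
theorem sStep_add (hG : ∀ j, ∃ δ C : ℝ, 0 < δ ∧ 0 ≤ C ∧ Decays (G j) C δ) (j : ℕ)
    (S T : Fin (d + 1) → (Fin (d + 1) → ℤ) → MKer (d + 1) (Fib d)) (hS : ∃ B : ℝ, ∀ κ u x z a b, |S κ u x z a b| ≤ B)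
    (hT : ∃ B : ℝ, ∀ κ u x z a b, |T κ u x z a b| ≤ B) :
    (fun κ' u' => c j • e3OfK N (G j) (S + T) κ' u') =
      (fun κ' u' => c j • e3OfK N (G j) S κ' u') + (fun κ' u' => c j • e3OfK N (G j) T κ' u') := by
  obtain ⟨δ, C, hδ, hC, hK⟩ := hG j
  obtain ⟨BS, hBS⟩ := hS
  obtain ⟨BT, hBT⟩ := hT
  funext κ' u'
  rw [Pi.add_apply, Pi.add_apply, ← smul_add, ← e3OfK_add_of_bdd hK hδ hC N hBS hBT κ' u']
  rfl

/-- [folklore] The BLOCK-SUMMED S-steps preserve boundedness of label-tables. -/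
theorem bdd_blockSStep (hG : ∀ j, ∃ δ C : ℝ, 0 < δ ∧ 0 ≤ C ∧ Decays (G j) C δ) (j : ℕ)
    {Φ : (Fin (d + 1) → ℤ) → Fin (d + 1) → (Fin (d + 1) → ℤ) → MKer (d + 1) (Fib d)} (hΦ : ∃ B : ℝ, ∀ y κ u x z a b, |Φ y κ u x z a b| ≤ B) :
    ∃ B : ℝ, ∀ y κ u x z a b,
      |(fun Y κ' u' => ∑ v ∈ box (d + 1) N, c j • e3OfK N (G j) (Φ ((N : ℤ) • Y + toSite v)) κ' u') y κ u x z a b| ≤ B := by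
  obtain ⟨δ, C, hδ, _, hK⟩ := hG j
  obtain ⟨B, hB⟩ := hΦ
  refine ⟨∑ _v ∈ box (d + 1) N, |c j| * ((Fintype.card (Fib d) : ℝ) * ((Fintype.card (Fib d) : ℝ) *
      (C * ExpKernelCalculus.Zl (d + 1) δ * (((d + 1 : ℕ) : ℝ) * (C * ExpKernelCalculus.Zl (d + 1) δ * B))) * (C * ExpKernelCalculus.Zl (d + 1) δ))),
    fun y κ u x z a b => ?_⟩
  show |(∑ v ∈ box (d + 1) N, c j • e3OfK N (G j) (Φ ((N : ℤ) • y + toSite v)) κ u) x z a b| ≤ _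
  rw [Finset.sum_apply, Finset.sum_apply, Finset.sum_apply, Finset.sum_apply]
  refine (Finset.abs_sum_le_sum_abs _ _).trans (Finset.sum_le_sum fun v _ => ?_)
  rw [Pi.smul_apply, Pi.smul_apply, Pi.smul_apply, Pi.smul_apply, smul_eq_mul, abs_mul]
  exact mul_le_mul_of_nonneg_left (bdd_e3OfK hK hδ N (hB _) κ u x z a b) (abs_nonneg _)

/-- [folklore] The BLOCK-SUMMED S-steps are additive on bounded label-tables. -/
theorem blockSStep_add (hG : ∀ j, ∃ δ C : ℝ, 0 < δ ∧ 0 ≤ C ∧ Decays (G j) C δ) (j : ℕ)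
    (Φ Φ' : (Fin (d + 1) → ℤ) → Fin (d + 1) → (Fin (d + 1) → ℤ) → MKer (d + 1) (Fib d))
    (hΦ : ∃ B : ℝ, ∀ y κ u x z a b, |Φ y κ u x z a b| ≤ B) (hΦ' : ∃ B : ℝ, ∀ y κ u x z a b, |Φ' y κ u x z a b| ≤ B) :
    (fun Y κ' u' => ∑ v ∈ box (d + 1) N, c j • e3OfK N (G j) ((Φ + Φ') ((N : ℤ) • Y + toSite v)) κ' u') =
      (fun Y κ' u' => ∑ v ∈ box (d + 1) N, c j • e3OfK N (G j) (Φ ((N : ℤ) • Y + toSite v)) κ' u') +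
        (fun Y κ' u' => ∑ v ∈ box (d + 1) N, c j • e3OfK N (G j) (Φ' ((N : ℤ) • Y + toSite v)) κ' u') := by
  obtain ⟨B, hB⟩ := hΦ
  obtain ⟨B', hB'⟩ := hΦ'
  funext Y κ' u'
  rw [Pi.add_apply, Pi.add_apply, Pi.add_apply, ← Finset.sum_add_distrib]
  refine Finset.sum_congr rfl fun v _ => ?_
  have h := congrFun (congrFun (sStep_add N G c hG j (Φ ((N : ℤ) • Y + toSite v)) (Φ' ((N : ℤ) • Y + toSite v)) ⟨B, hB _⟩ ⟨B', hB' _⟩) κ') u'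
  simpa only [Pi.add_apply] using h

/-- [folklore] **BLOCK SUMS NEST.**  For decaying kernels `G j`, scalars `c j`, a blocking `N ≥ 1` and a BOUNDED label-table `Φ`, the `k`-fold composite (from level `m`) of the
block-summed S-steps `𝔄 j Φ := fun Y κ′u′ ↦ Σ_{v∈box N} c j • e3OfK N (G j) (Φ (N•Y+v)) κ′u′` IS the block sum over the `N^k`-block of the `k`-fold composite of the PLAIN
S-steps `𝔖 j S := fun κ′u′ ↦ c j • e3OfK N (G j) S κ′u′`: `transport 𝔄 m k Φ = fun Ȳ κ′u′ ↦ Σ_{w∈box (N^k)} transport 𝔖 m k (Φ (N^k•Ȳ + w)) κ′u′`. -/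
theorem transport_blockSStep_eq (hG : ∀ j, ∃ δ C : ℝ, 0 < δ ∧ 0 ≤ C ∧ Decays (G j) C δ) (hN : 1 ≤ N) (k : ℕ) :
    ∀ (m : ℕ) {Φ : (Fin (d + 1) → ℤ) → Fin (d + 1) → (Fin (d + 1) → ℤ) → MKer (d + 1) (Fib d)},
      (∃ B : ℝ, ∀ y κ u x z a b, |Φ y κ u x z a b| ≤ B) →
      transport (fun j (Ψ : (Fin (d + 1) → ℤ) → Fin (d + 1) → (Fin (d + 1) → ℤ) → MKer (d + 1) (Fib d)) =>
          fun Y κ' u' => ∑ v ∈ box (d + 1) N, c j • e3OfK N (G j) (Ψ ((N : ℤ) • Y + toSite v)) κ' u') m k Φ =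
        fun Yc κ' u' => ∑ w ∈ box (d + 1) (N ^ k),
          transport (fun j (S : Fin (d + 1) → (Fin (d + 1) → ℤ) → MKer (d + 1) (Fib d)) => fun κ' u' => c j • e3OfK N (G j) S κ' u') m k
            (Φ (((N ^ k : ℕ) : ℤ) • Yc + toSite w)) κ' u' := by
  induction k with
  | zero =>
    intro m Φ _
    funext Yc κ' u'
    simp only [transport_zero, pow_zero]
    rw [sum_box_one (fun y => Φ y κ' u')]
  | succ k ih =>
    intro m Φ hΦ
    -- the class of bounded PLAIN tables: contains `0`, closed under `+`, preserved by the plain S-steps, which are additive on it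
    have hP0 : ∃ B : ℝ, ∀ κ u x z a b, |(0 : Fin (d + 1) → (Fin (d + 1) → ℤ) → MKer (d + 1) (Fib d)) κ u x z a b| ≤ B :=
      ⟨0, fun κ u x z a b => by simp⟩
    have hPadd : ∀ S T : Fin (d + 1) → (Fin (d + 1) → ℤ) → MKer (d + 1) (Fib d),
        (∃ B : ℝ, ∀ κ u x z a b, |S κ u x z a b| ≤ B) → (∃ B : ℝ, ∀ κ u x z a b, |T κ u x z a b| ≤ B) →
        ∃ B : ℝ, ∀ κ u x z a b, |(S + T) κ u x z a b| ≤ B := by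
      rintro S T ⟨BS, hS⟩ ⟨BT, hT⟩
      exact ⟨BS + BT, fun κ u x z a b => by
        simp only [Pi.add_apply]
        exact (abs_add_le _ _).trans (add_le_add (hS κ u x z a b) (hT κ u x z a b))⟩
    rw [transport_succ', ih (m + 1) (bdd_blockSStep N G c hG m hΦ)]
    funext Yc κ' u'
    -- inner: `(𝔄 m Φ) (N^k•Yc + w) = Σ_v 𝔖 m (Φ (N•(N^k•Yc+w) + v))`, transported termwise by additivity, then `transport_succ'` backwards
    have hsum : ∀ w : Fin (d + 1) → ℕ,
        transport (fun j (S : Fin (d + 1) → (Fin (d + 1) → ℤ) → MKer (d + 1) (Fib d)) => fun κ' u' => c j • e3OfK N (G j) S κ' u') (m + 1) k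
            ((fun Y κ' u' => ∑ v ∈ box (d + 1) N, c m • e3OfK N (G m) (Φ ((N : ℤ) • Y + toSite v)) κ' u') (((N ^ k : ℕ) : ℤ) • Yc + toSite w)) =
          ∑ v ∈ box (d + 1) N, transport (fun j (S : Fin (d + 1) → (Fin (d + 1) → ℤ) → MKer (d + 1) (Fib d)) =>
            fun κ' u' => c j • e3OfK N (G j) S κ' u') m (k + 1) (Φ ((N : ℤ) • ((((N ^ k : ℕ) : ℤ) • Yc + toSite w)) + toSite v)) := by
      intro w
      have e1 : ((fun Y κ' u' => ∑ v ∈ box (d + 1) N, c m • e3OfK N (G m) (Φ ((N : ℤ) • Y + toSite v)) κ' u') (((N ^ k : ℕ) : ℤ) • Yc + toSite w)) =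
          ∑ v ∈ box (d + 1) N, (fun κ' u' => c m • e3OfK N (G m) (Φ ((N : ℤ) • ((((N ^ k : ℕ) : ℤ) • Yc + toSite w)) + toSite v)) κ' u') := by
        funext κ' u'
        simp only [Finset.sum_apply]
      rw [e1, transport_sum (A := fun j (S : Fin (d + 1) → (Fin (d + 1) → ℤ) → MKer (d + 1) (Fib d)) => fun κ' u' => c j • e3OfK N (G j) S κ' u')
        (P := fun S => ∃ B : ℝ, ∀ κ u x z a b, |S κ u x z a b| ≤ B) hP0 hPadd (fun j S hS => bdd_sStep N G c hG j hS)
        (fun j S T hS hT => sStep_add N G c hG j S T hS hT) (m + 1) k]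
      · refine Finset.sum_congr rfl fun v _ => ?_
        rw [transport_succ']
      · intro v _
        obtain ⟨B, hB⟩ := hΦ
        exact bdd_sStep N G c hG m ⟨B, hB _⟩
    simp only [hsum, Finset.sum_apply]
    rw [pow_succ', sum_box_mul hN (N ^ k) (fun y => transport (fun j (S : Fin (d + 1) → (Fin (d + 1) → ℤ) → MKer (d + 1) (Fib d)) =>
      fun κ' u' => c j • e3OfK N (G j) S κ' u') m (k + 1) (Φ y) κ' u') Yc]

end Nest

/-! ## §4 Duhamel for the block-summed S-tower, every source block-summed over the grown block -/

section Duhamel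

variable (N : ℕ) (G : ℕ → MKer (d + 1) (Fib d)) (c : ℕ → ℝ)

/-- [folklore] **DISCRETE DUHAMEL FOR THE BLOCK-SUMMED S-TOWER** (leaf-01's `AffineUnroll.eq_transport_add_sum` on the class of bounded label-tables): for any tower
`Φ (j+1) = 𝔄 j (Φ j) + σ j` with bounded `Φ 0` and bounded sources, `Φ n = transport 𝔄 0 n (Φ 0) + Σ_{m<n} transport 𝔄 (m+1) (n−1−m) (σ m)`. -/
theorem eq_transport_add_sum_blockSStep (hG : ∀ j, ∃ δ C : ℝ, 0 < δ ∧ 0 ≤ C ∧ Decays (G j) C δ)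
    {Φ σ : ℕ → (Fin (d + 1) → ℤ) → Fin (d + 1) → (Fin (d + 1) → ℤ) → MKer (d + 1) (Fib d)}
    (hΦ0 : ∃ B : ℝ, ∀ y κ u x z a b, |Φ 0 y κ u x z a b| ≤ B) (hσ : ∀ j, ∃ B : ℝ, ∀ y κ u x z a b, |σ j y κ u x z a b| ≤ B)
    (hrec : ∀ j, Φ (j + 1) = (fun Y κ' u' => ∑ v ∈ box (d + 1) N, c j • e3OfK N (G j) (Φ j ((N : ℤ) • Y + toSite v)) κ' u') + σ j) (n : ℕ) :
    Φ n = transport (fun j (Ψ : (Fin (d + 1) → ℤ) → Fin (d + 1) → (Fin (d + 1) → ℤ) → MKer (d + 1) (Fib d)) =>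
          fun Y κ' u' => ∑ v ∈ box (d + 1) N, c j • e3OfK N (G j) (Ψ ((N : ℤ) • Y + toSite v)) κ' u') 0 n (Φ 0)
      + ∑ m ∈ Finset.range n, transport (fun j (Ψ : (Fin (d + 1) → ℤ) → Fin (d + 1) → (Fin (d + 1) → ℤ) → MKer (d + 1) (Fib d)) =>
          fun Y κ' u' => ∑ v ∈ box (d + 1) N, c j • e3OfK N (G j) (Ψ ((N : ℤ) • Y + toSite v)) κ' u') (m + 1) (n - 1 - m) (σ m) := by
  have hP0 : ∃ B : ℝ, ∀ y κ u x z a b, |(0 : (Fin (d + 1) → ℤ) → Fin (d + 1) → (Fin (d + 1) → ℤ) → MKer (d + 1) (Fib d)) y κ u x z a b| ≤ B :=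
    ⟨0, fun y κ u x z a b => by simp⟩
  have hPadd : ∀ Φ₁ Φ₂ : (Fin (d + 1) → ℤ) → Fin (d + 1) → (Fin (d + 1) → ℤ) → MKer (d + 1) (Fib d),
      (∃ B : ℝ, ∀ y κ u x z a b, |Φ₁ y κ u x z a b| ≤ B) → (∃ B : ℝ, ∀ y κ u x z a b, |Φ₂ y κ u x z a b| ≤ B) →
      ∃ B : ℝ, ∀ y κ u x z a b, |(Φ₁ + Φ₂) y κ u x z a b| ≤ B := by
    rintro Φ₁ Φ₂ ⟨B₁, h₁⟩ ⟨B₂, h₂⟩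
    exact ⟨B₁ + B₂, fun y κ u x z a b => by
      simp only [Pi.add_apply]
      exact (abs_add_le _ _).trans (add_le_add (h₁ y κ u x z a b) (h₂ y κ u x z a b))⟩
  exact eq_transport_add_sum (P := fun Φ => ∃ B : ℝ, ∀ y κ u x z a b, |Φ y κ u x z a b| ≤ B) hP0 hPadd
    (fun j Φ hΦ => bdd_blockSStep N G c hG j hΦ) (fun j Φ Φ' hΦ hΦ' => blockSStep_add N G c hG j Φ Φ' hΦ hΦ') hΦ0 hσ hrec n

/-- [folklore] **THE MEMBER AT A LABEL, EVERY SOURCE TRANSPORTED BY THE PLAIN S-TOWER AND BLOCK-SUMMED OVER THE GROWN BLOCK** (Duhamel + block sums nest):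
`Φ n Ȳ κ′u′ = Σ_{w∈box (N^n)} transport 𝔖 0 n (Φ 0 (N^n•Ȳ + w)) κ′u′ + Σ_{m<n} Σ_{w∈box (N^{n−1−m})} transport 𝔖 (m+1) (n−1−m) (σ m (N^{n−1−m}•Ȳ + w)) κ′u′`. -/
theorem apply_eq_sum_box_transport (hG : ∀ j, ∃ δ C : ℝ, 0 < δ ∧ 0 ≤ C ∧ Decays (G j) C δ) (hN : 1 ≤ N)
    {Φ σ : ℕ → (Fin (d + 1) → ℤ) → Fin (d + 1) → (Fin (d + 1) → ℤ) → MKer (d + 1) (Fib d)}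
    (hΦ0 : ∃ B : ℝ, ∀ y κ u x z a b, |Φ 0 y κ u x z a b| ≤ B) (hσ : ∀ j, ∃ B : ℝ, ∀ y κ u x z a b, |σ j y κ u x z a b| ≤ B)
    (hrec : ∀ j, Φ (j + 1) = (fun Y κ' u' => ∑ v ∈ box (d + 1) N, c j • e3OfK N (G j) (Φ j ((N : ℤ) • Y + toSite v)) κ' u') + σ j)
    (n : ℕ) (Yc : Fin (d + 1) → ℤ) (κ' : Fin (d + 1)) (u' : Fin (d + 1) → ℤ) :
    Φ n Yc κ' u' =
      ∑ w ∈ box (d + 1) (N ^ n), transport (fun j (S : Fin (d + 1) → (Fin (d + 1) → ℤ) → MKer (d + 1) (Fib d)) =>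
          fun κ' u' => c j • e3OfK N (G j) S κ' u') 0 n (Φ 0 (((N ^ n : ℕ) : ℤ) • Yc + toSite w)) κ' u'
      + ∑ m ∈ Finset.range n, ∑ w ∈ box (d + 1) (N ^ (n - 1 - m)),
          transport (fun j (S : Fin (d + 1) → (Fin (d + 1) → ℤ) → MKer (d + 1) (Fib d)) => fun κ' u' => c j • e3OfK N (G j) S κ' u') (m + 1) (n - 1 - m)
            (σ m (((N ^ (n - 1 - m) : ℕ) : ℤ) • Yc + toSite w)) κ' u' := by
  have h := eq_transport_add_sum_blockSStep N G c hG hΦ0 hσ hrec n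
  rw [transport_blockSStep_eq N G c hG hN n 0 hΦ0] at h
  have h' : ∀ m ∈ Finset.range n, transport (fun j (Ψ : (Fin (d + 1) → ℤ) → Fin (d + 1) → (Fin (d + 1) → ℤ) → MKer (d + 1) (Fib d)) =>
        fun Y κ' u' => ∑ v ∈ box (d + 1) N, c j • e3OfK N (G j) (Ψ ((N : ℤ) • Y + toSite v)) κ' u') (m + 1) (n - 1 - m) (σ m) =
      fun Yc κ' u' => ∑ w ∈ box (d + 1) (N ^ (n - 1 - m)),
        transport (fun j (S : Fin (d + 1) → (Fin (d + 1) → ℤ) → MKer (d + 1) (Fib d)) => fun κ' u' => c j • e3OfK N (G j) S κ' u') (m + 1) (n - 1 - m)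
          (σ m (((N ^ (n - 1 - m) : ℕ) : ℤ) • Yc + toSite w)) κ' u' :=
    fun m _ => transport_blockSStep_eq N G c hG hN (n - 1 - m) (m + 1) (hσ m)
  rw [Finset.sum_congr rfl h'] at h
  have := congrFun (congrFun (congrFun h Yc) κ') u'
  simpa only [Pi.add_apply, Finset.sum_apply] using this

/-- [folklore] **… EQUIVALENTLY: EVERY TRANSPORTED OBJECT IS A BLOCK PARTIAL SUM** (additivity of the plain transport on bounded tables, `AffineUnroll.transport_sum`):
`Φ n Ȳ κ′u′ = transport 𝔖 0 n (Σ_{w∈box (N^n)} Φ 0 (N^n•Ȳ + w)) κ′u′ + Σ_{m<n} transport 𝔖 (m+1) (n−1−m) (Σ_{w∈box (N^{n−1−m})} σ m (N^{n−1−m}•Ȳ + w)) κ′u′` — the OWNER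
gan24-p1 g25's «QR-LL» shape `Φ_k(Y) = 𝒮_{0→k}[Φ_0^{B^k(Y)}] + Σ_{i<k} 𝒮_{i+1→k}[σ_i^{B^{k−1−i}(Y)}]` (W2, journal 2026-08-22T03:32Z): the PLAIN S-tower's composite maps applied to
the SUPER-BLOCK PARTIAL SUMS of the initial table and of the sources. -/
theorem apply_eq_transport_blockSum (hG : ∀ j, ∃ δ C : ℝ, 0 < δ ∧ 0 ≤ C ∧ Decays (G j) C δ) (hN : 1 ≤ N)
    {Φ σ : ℕ → (Fin (d + 1) → ℤ) → Fin (d + 1) → (Fin (d + 1) → ℤ) → MKer (d + 1) (Fib d)}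
    (hΦ0 : ∃ B : ℝ, ∀ y κ u x z a b, |Φ 0 y κ u x z a b| ≤ B) (hσ : ∀ j, ∃ B : ℝ, ∀ y κ u x z a b, |σ j y κ u x z a b| ≤ B)
    (hrec : ∀ j, Φ (j + 1) = (fun Y κ' u' => ∑ v ∈ box (d + 1) N, c j • e3OfK N (G j) (Φ j ((N : ℤ) • Y + toSite v)) κ' u') + σ j)
    (n : ℕ) (Yc : Fin (d + 1) → ℤ) (κ' : Fin (d + 1)) (u' : Fin (d + 1) → ℤ) :
    Φ n Yc κ' u' =
      transport (fun j (S : Fin (d + 1) → (Fin (d + 1) → ℤ) → MKer (d + 1) (Fib d)) => fun κ' u' => c j • e3OfK N (G j) S κ' u') 0 n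
          (∑ w ∈ box (d + 1) (N ^ n), Φ 0 (((N ^ n : ℕ) : ℤ) • Yc + toSite w)) κ' u'
      + ∑ m ∈ Finset.range n,
          transport (fun j (S : Fin (d + 1) → (Fin (d + 1) → ℤ) → MKer (d + 1) (Fib d)) => fun κ' u' => c j • e3OfK N (G j) S κ' u') (m + 1) (n - 1 - m)
            (∑ w ∈ box (d + 1) (N ^ (n - 1 - m)), σ m (((N ^ (n - 1 - m) : ℕ) : ℤ) • Yc + toSite w)) κ' u' := by
  -- the class of bounded PLAIN tables
  have hP0 : ∃ B : ℝ, ∀ κ u x z a b, |(0 : Fin (d + 1) → (Fin (d + 1) → ℤ) → MKer (d + 1) (Fib d)) κ u x z a b| ≤ B :=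
    ⟨0, fun κ u x z a b => by simp⟩
  have hPadd : ∀ S T : Fin (d + 1) → (Fin (d + 1) → ℤ) → MKer (d + 1) (Fib d),
      (∃ B : ℝ, ∀ κ u x z a b, |S κ u x z a b| ≤ B) → (∃ B : ℝ, ∀ κ u x z a b, |T κ u x z a b| ≤ B) →
      ∃ B : ℝ, ∀ κ u x z a b, |(S + T) κ u x z a b| ≤ B := by
    rintro S T ⟨BS, hS⟩ ⟨BT, hT⟩
    exact ⟨BS + BT, fun κ u x z a b => by
      simp only [Pi.add_apply]
      exact (abs_add_le _ _).trans (add_le_add (hS κ u x z a b) (hT κ u x z a b))⟩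
  have hsum : ∀ (m k M : ℕ) (F : (Fin (d + 1) → ℤ) → Fin (d + 1) → (Fin (d + 1) → ℤ) → MKer (d + 1) (Fib d)),
      (∃ B : ℝ, ∀ y κ u x z a b, |F y κ u x z a b| ≤ B) →
      transport (fun j (S : Fin (d + 1) → (Fin (d + 1) → ℤ) → MKer (d + 1) (Fib d)) => fun κ' u' => c j • e3OfK N (G j) S κ' u') m k
          (∑ w ∈ box (d + 1) M, F (((M : ℕ) : ℤ) • Yc + toSite w)) =
        ∑ w ∈ box (d + 1) M, transport (fun j (S : Fin (d + 1) → (Fin (d + 1) → ℤ) → MKer (d + 1) (Fib d)) =>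
          fun κ' u' => c j • e3OfK N (G j) S κ' u') m k (F (((M : ℕ) : ℤ) • Yc + toSite w)) := by
    intro m k M F hF
    obtain ⟨B, hB⟩ := hF
    exact transport_sum (A := fun j (S : Fin (d + 1) → (Fin (d + 1) → ℤ) → MKer (d + 1) (Fib d)) => fun κ' u' => c j • e3OfK N (G j) S κ' u')
      (P := fun S => ∃ B : ℝ, ∀ κ u x z a b, |S κ u x z a b| ≤ B) hP0 hPadd (fun j S hS => bdd_sStep N G c hG j hS)
      (fun j S T hS hT => sStep_add N G c hG j S T hS hT) m k _ _ (fun w _ => ⟨B, hB _⟩)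
  rw [apply_eq_sum_box_transport N G c hG hN hΦ0 hσ hrec n Yc κ' u', hsum 0 n (N ^ n) (Φ 0) hΦ0, Finset.sum_apply, Finset.sum_apply]
  congr 1
  refine Finset.sum_congr rfl fun m _ => ?_
  rw [hsum (m + 1) (n - 1 - m) (N ^ (n - 1 - m)) (σ m) (hσ m), Finset.sum_apply, Finset.sum_apply]

end Duhamel

end Summit.QuantumFields.BalabanUV.Beta.GAN24.WardResidualSUnroll

end
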